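import Mathlib
import HarnessLib
import Summits.NavierStokesRegularity.NavierStokesRegularity.Theorems.HalfSpaceWindowDoorCirculationCarryingRigidityPeriodicStratum
import Summits.NavierStokesRegularity.NavierStokesRegularity.Theorems.ScenarioCensusAncientAnnex

/-!
# Route `HalfSpaceWindowDoor`, crux `CirculationCarryingRigidity` (stmt-NavierStokesRegularity-25311) —
# the periodic / helical stratum in the vocabulary of the blow-up SCENARIO CENSUS (rows A13, A8t, R8t — Oseen class)

LEAD ns-hsw-p1 g7 (cell pub-ns-dss), `--supports stmt-NavierStokesRegularity-25311 --as helper`; a reading aid for the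
census cell `pub/ns-census` (director-ns D-0154 (A)).  The census files `ScenarioCensusAncientSymmetry.lean` /
`ScenarioCensusAncientAnnex.lean` type the rows

* A13 «PeriodicTypeILiouville» (`Row_A13`, `@[conjecture]`, OPEN): TIME-only Type I + `P`-periodic along the axis + ancient
  mild ⇒ every slice a.e. constant;
* A8t (`Row_A8t`, OPEN; only `row_A8t_of_liouvilleConjectureNS`): TIME-only Type I + HELICAL of pitch `h ≠ 0` ⇒ a.e. constant;
* R8t (`Row_R8t`, OPEN; `row_R8t_of_row_A8t`): the same for rotated-DSS profiles,

in the census's class of record — the DUALITY-form ancient mild solutions with measurable slices, where spatially constant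
Type-I fields `(−t)^{−1/2}e₃` live, so that «a.e. constant» is the sharp conclusion.  The route class of the window doors is
the CONTINUOUS OSEEN-MILD class (Type-I time rate, continuity on the open slab, the unit-viscosity Oseen–Duhamel identity
pointwise between negative times, divergence-free slices) — the class of every blow-up profile produced by a point zoom of a
classical Type-I singularity (`HalfSpaceZoom`, `LocalPointZoomSlices`).  In THAT class the three rows are now theorems with
the conclusion `u ≡ 0`, by the periodic-stratum theorem `…PeriodicStratum.eq_zero_of_periodic` (p665830; blow-down kills the
pitch + forward/backward ε-regularity):

* `row_A13_oseen` — TIME-only Type I · `P`-periodic along the axis (`IsZPeriodic P`, any `P ≠ 0`) · continuous Oseen-mild ⇒ `u ≡ 0`;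
* `row_A8t_oseen` — TIME-only Type I · HELICAL of pitch `h ≠ 0` (`u(t, R_θ x + hθ e₃) = R_θ u(t, x)`) · continuous Oseen-mild
  ⇒ `u ≡ 0` (one full turn is the axial period `2π|h|`: the census's `isZPeriodic_of_helical`);
* `row_R8t_oseen` — the same with a (carried, unused) rotated-DSS hypothesis, matching the shape of `Row_R8t`;
* `inner_curl_e3_eq_zero_of_helical` — for the crux: helical door-class profiles are poloidal (indeed zero), sign-free.

The duality-class rows `Row_A13` / `Row_A8t` / `Row_R8t` themselves stay OPEN here: passing from a duality-form solution to a
continuous Oseen-mild representative with the SAME Type-I rate needs the §4 representative `U` of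
`KNSS2009_regularity_boundedWeak_ancient` to satisfy the Oseen–Duhamel identity, which that fact does not assert (the parasitic
gauge `b(t)`); this file does not attempt it.

WHAT THIS IS NOT: not a statement about Navier–Stokes regularity; census rows and door statements concern HYPOTHETICAL blow-up
profiles.  No item is closed by this file.
-/

noncomputable section

-- the summit and its single sub-problem share the name (CONVENTIONS §1), as in every Theorems file
set_option linter.dupNamespace false

namespace Summit.NavierStokesRegularity.NavierStokesRegularity.Theorems.HalfSpaceWindowDoorCirculationCarryingRigidityPeriodicStratumCensus

open MeasureTheory Set Function Filter Topology
open scoped RealInnerProductSpace InnerProductSpace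
open Literature.Analysis Literature.Analysis.FluidPDE
open Summit.NavierStokesRegularity.NavierStokesRegularity.Theorems.HalfSpaceWindowDoorCirculationCarryingRigidityDefs
open Summit.NavierStokesRegularity.NavierStokesRegularity.Theorems.HalfSpaceWindowDoorCirculationCarryingRigidityPeriodicStratum
  (eq_zero_of_periodic inner_curl_e3_eq_zero_of_periodic)
open Summit.NavierStokesRegularity.NavierStokesRegularity.Theorems.ScenarioCensus
  (IsZPeriodic isZPeriodic_of_helical twoPi_mul_abs_pitch_pos)

/-- **Census row A13 in the continuous Oseen-mild class** (TIME-only Type I `‖u(t,x)‖ ≤ C/√(−t)` · `P`-PERIODIC along the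
axis at every `t < 0`, `P ≠ 0` · NO symmetry · continuous Oseen-mild with divergence-free slices): `u ≡ 0` on the open lower
slab.  (`…PeriodicStratum.eq_zero_of_periodic` with the period vector `P e₃`.) -/
theorem row_A13_oseen {P : ℝ} (hP : P ≠ 0) {u : ℝ → EuclideanSpace ℝ (Fin 3) → EuclideanSpace ℝ (Fin 3)}
    (hdec : ∃ C : ℝ, HasTypeITimeDecay C u) (hcont : ContinuousOn (uncurry u) (Iio (0 : ℝ) ×ˢ univ))
    (hmild : ∀ s t : ℝ, s < t → t < 0 → ∀ x,
      u t x = UnboundedOperators.heatExtension (u s) (t - s) x - oseenDuhamel 1 s u u t x)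
    (hdiv : ∀ t < 0, VectorCalculus.IsDivFree (u t)) (hper : ∀ t < 0, IsZPeriodic P (u t)) :
    ∀ t < 0, ∀ x, u t x = 0 := by
  obtain ⟨C, hC⟩ := hdec
  have he : (P • EuclideanSpace.single (2 : Fin 3) (1 : ℝ) : EuclideanSpace ℝ (Fin 3)) ≠ 0 := by
    refine smul_ne_zero hP fun h0 => ?_
    have : (EuclideanSpace.single (2 : Fin 3) (1 : ℝ) : EuclideanSpace ℝ (Fin 3)) 2 = 0 := by rw [h0]; rfl
    simp at this
  exact eq_zero_of_periodic hC hcont hmild hdiv he fun t ht x => hper t ht x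

/-- **Census row A8t in the continuous Oseen-mild class** (TIME-only Type I · HELICAL of pitch `h ≠ 0`:
`u(t, R_θ x + hθ e₃) = R_θ u(t, x)` for all `θ`, `x`, `t < 0` · continuous Oseen-mild with divergence-free slices): `u ≡ 0`.
One full turn is the axial translation by `2π|h| e₃` (`isZPeriodic_of_helical`), so `row_A13_oseen` applies. -/
theorem row_A8t_oseen {h : ℝ} (hh : h ≠ 0) {u : ℝ → EuclideanSpace ℝ (Fin 3) → EuclideanSpace ℝ (Fin 3)}
    (hdec : ∃ C : ℝ, HasTypeITimeDecay C u) (hcont : ContinuousOn (uncurry u) (Iio (0 : ℝ) ×ˢ univ))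
    (hmild : ∀ s t : ℝ, s < t → t < 0 → ∀ x,
      u t x = UnboundedOperators.heatExtension (u s) (t - s) x - oseenDuhamel 1 s u u t x)
    (hdiv : ∀ t < 0, VectorCalculus.IsDivFree (u t))
    (hhel : ∀ t < 0, ∀ (θ : ℝ) (x : EuclideanSpace ℝ (Fin 3)),
      u t (FluidPDE.rotZ θ x + (h * θ) • EuclideanSpace.single 2 (1 : ℝ)) = FluidPDE.rotZ θ (u t x)) :
    ∀ t < 0, ∀ x, u t x = 0 :=
  row_A13_oseen (twoPi_mul_abs_pitch_pos hh).ne' hdec hcont hmild hdiv fun t ht => isZPeriodic_of_helical hh (hhel t ht)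

/-- **Census row R8t in the continuous Oseen-mild class** (TIME-only Type I · rotated-DSS (carried, not used) · HELICAL of
pitch `h ≠ 0` · continuous Oseen-mild with divergence-free slices): `u ≡ 0`. -/
theorem row_R8t_oseen {h : ℝ} (hh : h ≠ 0) {c : ℝ} (_hc : 1 < c)
    (R : EuclideanSpace ℝ (Fin 3) ≃ₗᵢ[ℝ] EuclideanSpace ℝ (Fin 3))
    {u : ℝ → EuclideanSpace ℝ (Fin 3) → EuclideanSpace ℝ (Fin 3)} (_hdss : FluidPDE.IsRotatedDSS c R u)
    (hdec : ∃ C : ℝ, HasTypeITimeDecay C u) (hcont : ContinuousOn (uncurry u) (Iio (0 : ℝ) ×ˢ univ))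
    (hmild : ∀ s t : ℝ, s < t → t < 0 → ∀ x,
      u t x = UnboundedOperators.heatExtension (u s) (t - s) x - oseenDuhamel 1 s u u t x)
    (hdiv : ∀ t < 0, VectorCalculus.IsDivFree (u t))
    (hhel : ∀ t < 0, ∀ (θ : ℝ) (x : EuclideanSpace ℝ (Fin 3)),
      u t (FluidPDE.rotZ θ x + (h * θ) • EuclideanSpace.single 2 (1 : ℝ)) = FluidPDE.rotZ θ (u t x)) :
    ∀ t < 0, ∀ x, u t x = 0 :=
  row_A8t_oseen hh hdec hcont hmild hdiv hhel

/-- **For the crux: helical door-class profiles are poloidal** (indeed zero; the closed-hemisphere sign is not needed):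
`⟪curl u(s), e₃⟫ ≡ 0` for every profile of the route's Type-I ancient Oseen-mild class that is helically symmetric about the
vertical axis with pitch `h ≠ 0`. -/
theorem inner_curl_e3_eq_zero_of_helical {h : ℝ} (hh : h ≠ 0) {C : ℝ}
    {u : ℝ → EuclideanSpace ℝ (Fin 3) → EuclideanSpace ℝ (Fin 3)}
    (hrate : HasTypeITimeDecay C u) (hcont : ContinuousOn (uncurry u) (Iio (0 : ℝ) ×ˢ univ))
    (hmild : ∀ s t : ℝ, s < t → t < 0 → ∀ x,
      u t x = UnboundedOperators.heatExtension (u s) (t - s) x - oseenDuhamel 1 s u u t x)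
    (hdiv : ∀ t < 0, VectorCalculus.IsDivFree (u t))
    (hhel : ∀ t < 0, ∀ (θ : ℝ) (x : EuclideanSpace ℝ (Fin 3)),
      u t (FluidPDE.rotZ θ x + (h * θ) • EuclideanSpace.single 2 (1 : ℝ)) = FluidPDE.rotZ θ (u t x)) :
    ∀ s < 0, ∀ y, ⟪curl (u s) y, e3⟫ = 0 := by
  have he : ((2 * Real.pi * |h|) • EuclideanSpace.single (2 : Fin 3) (1 : ℝ) : EuclideanSpace ℝ (Fin 3)) ≠ 0 := by
    refine smul_ne_zero (twoPi_mul_abs_pitch_pos hh).ne' fun h0 => ?_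
    have : (EuclideanSpace.single (2 : Fin 3) (1 : ℝ) : EuclideanSpace ℝ (Fin 3)) 2 = 0 := by rw [h0]; rfl
    simp at this
  exact inner_curl_e3_eq_zero_of_periodic hrate hcont hmild hdiv he
    fun t ht x => isZPeriodic_of_helical hh (hhel t ht) x

/-- **Helical door-class profiles are trivial, bundled form** (`InDoorClass` of `…Defs`). -/
theorem eq_zero_of_helical {h : ℝ} (hh : h ≠ 0) {C : ℝ}
    {u : ℝ → EuclideanSpace ℝ (Fin 3) → EuclideanSpace ℝ (Fin 3)} (hu : InDoorClass C u)
    (hhel : ∀ t < 0, ∀ (θ : ℝ) (x : EuclideanSpace ℝ (Fin 3)),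
      u t (FluidPDE.rotZ θ x + (h * θ) • EuclideanSpace.single 2 (1 : ℝ)) = FluidPDE.rotZ θ (u t x)) :
    ∀ t < 0, ∀ x, u t x = 0 :=
  row_A8t_oseen hh ⟨C, hu.1⟩ hu.2.1 hu.2.2.1 hu.2.2.2 hhel

end Summit.NavierStokesRegularity.NavierStokesRegularity.Theorems.HalfSpaceWindowDoorCirculationCarryingRigidityPeriodicStratumCensus

end
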